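import Mathlib
import Summits.ValiantsHypothesis.ValiantsHypothesis.Theorems.LacunarySymmetroidMatrixDescartesCensusDefs
import Summits.ValiantsHypothesis.ValiantsHypothesis.Theorems.LacunarySymmetroidMatrixDescartesStubNegRoots
import Summits.ValiantsHypothesis.ValiantsHypothesis.Theorems.LacunarySymmetroidMatrixDescartesRolleSchurCompression

/-!
# Crux `MatrixDescartes` (stmt-ValiantsHypothesis-18050), line `rolle-schur-residual` —
# STUB `stub_telescope : IncrementTelescope` (`IncrementLaw → KPlusLogSqLaw`), PROVED

Line file: `Summits/ValiantsHypothesis/ValiantsHypothesis/Cruxes/MatrixDescartes/Lines/rolle_schur_residual.lean`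
(ideator val-idea-3), stub K2 (support, M).  The statement `incrementTelescope` below is the
line's Prop `IncrementTelescope := IncrementLaw → KPlusLogSqLaw` with the line's local vocabulary
(`pencil`, `adjVec`, `compDet`, `posRoots`, `IncrementLaw`) UNFOLDED to Mathlib terms (the line
file lives under `Cruxes/` and carries `sorry`s, so it cannot be imported); the two statements agree
definitionally, so the line closes its stub by `exact RolleSchur.incrementTelescope` (checked
against a verbatim copy of the line's definitions before landing).  `KPlusLogSqLaw` (Conjecture B,
`∃ C, ∀ m K, RealRootLawAt m K (2 ^ (C (K + log₂² m)))`) is the tree's Defs-module Prop.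

**Statement.**  INCREMENT LAW: for some `C₀`, every lacunary pencil `F = ∑ₗ X^{dₗ} Sₗ` with real
symmetric `m × m` letters, `det F ≢ 0`, `0 < m`, has a direction `w` with `a = wᵀ adj(F) w ≢ 0` and
`Z₊(det F) ≤ Z₊(a) + 2^{C₀ (K + log₂² m)}`.  CONCLUSION: Conjecture B with `C = C₀ + 4`.

**Proof.**  (1) `posRoots_le_mul_of_increment`: `Z₊(det F) ≤ m · 2^{C₀ (K + log₂² m)}` by
induction on `m`: the compression lemma (`RolleSchur.compDet_eq_C_mul_det_pencil`, companion file
`…RolleSchurCompression`) writes `a = C c · det F'` with `c ≠ 0` and `F'` an `(m−1, K)` pencil of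
the same exponent vector with symmetric letters, so `Z₊(a) = Z₊(det F')`, `det F' ≢ 0`, and the
induction hypothesis applies (`log₂` is monotone in `m`).  (2) The same bound for the reflected
pencil `F(−X)` (letters `(−1)^{dₗ} Sₗ`, tree `NegRoots.det_pencil_reflect_ne_zero`), and the tree's
`stub_negRoots`: `#real roots ≤ Z₊(F) + Z₊(F(−X)) + 1`.  (3) `telescope_arith`:
`2 m · 2^{C₀ E} + 1 ≤ 2^{(C₀ + 4) E}` for `E = K + log₂² m`, `K ≥ 1` (`m < 2^{log₂ m + 1}`,
`log₂ m ≤ log₂² m`).  Degenerate cases: `det F = 0` (no roots are counted), `m = 0` (`det = 1`),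
`K = 0` with `m ≥ 1` (zero pencil, `det = 0`).

Honest framing: an M-sized SUPPORT stub (bookkeeping: induction on `m` + arithmetic) of a
registered line of the V1 crux, instrument/structure tier; it makes the line's composition
`KPlusLogSqLaw_of = stub_telescope (incrementLaw_of_residualLaw stub_rolleSchurStep stub_residualLaw)`
depend on the single open law `stub_residualLaw` (XL, B-hard, NOT touched here).  The crux
`LacunarySymmetroid.MatrixDescartes`, Conjecture B (`KPlusLogSqLaw`) and rung V1 do NOT move;
`VP ≠ VNP` is NOT proved and nothing here is progress on it.  No definitions, no named facts.
-/

-- `Summit.ValiantsHypothesis.ValiantsHypothesis.…` is the tree's mandated single-conjunct layout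
-- (Sub = Summit), so the duplicated namespace component is intended.
set_option linter.dupNamespace false
set_option autoImplicit false

namespace Summit.ValiantsHypothesis.ValiantsHypothesis.Theorems.LacunarySymmetroidMatrixDescartes

open Polynomial Matrix Finset
open scoped BigOperators

namespace RolleSchur

/-! ## The telescope: `IncrementLaw → KPlusLogSqLaw` -/

/-- **Positive roots by telescoping the increment law.**  If for some `C₀` every lacunary pencil
`F = ∑ₗ X^{dₗ} Sₗ` with symmetric `m × m` letters, `det F ≢ 0`, `0 < m`, admits a direction `w`
with `a = wᵀ adj(F) w ≢ 0` and `Z₊(det F) ≤ Z₊(a) + 2^{C₀ (K + log₂² m)}`, then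
`Z₊(det F) ≤ m · 2^{C₀ (K + log₂² m)}` for every such pencil (induction on `m` through the
compression lemma `compDet_eq_C_mul_det_pencil`; `log₂` is monotone). [folklore] -/
theorem posRoots_le_mul_of_increment (C₀ : ℕ)
    (hinc : ∀ (m K : ℕ) (d : Fin K → ℕ) (S : Fin K → Matrix (Fin m) (Fin m) ℝ),
      (∀ l, (S l).IsSymm) → (∑ l, (X : ℝ[X]) ^ d l • (S l).map C).det ≠ 0 → 0 < m →
        ∃ w : Fin m → ℝ,
          (fun i => C (w i)) ⬝ᵥ ((∑ l, (X : ℝ[X]) ^ d l • (S l).map C).adjugate *ᵥ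
              fun i => C (w i)) ≠ 0 ∧
            ((∑ l, (X : ℝ[X]) ^ d l • (S l).map C).det.roots.toFinset.filter
                (fun x => 0 < x)).card ≤
              (((fun i => C (w i)) ⬝ᵥ ((∑ l, (X : ℝ[X]) ^ d l • (S l).map C).adjugate *ᵥ
                  fun i => C (w i))).roots.toFinset.filter (fun x => 0 < x)).card +
                2 ^ (C₀ * (K + Nat.log 2 m ^ 2)))
    (m K : ℕ) (d : Fin K → ℕ) (S : Fin K → Matrix (Fin m) (Fin m) ℝ) (hS : ∀ l, (S l).IsSymm)
    (hdet : (∑ l, (X : ℝ[X]) ^ d l • (S l).map C).det ≠ 0) :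
    ((∑ l, (X : ℝ[X]) ^ d l • (S l).map C).det.roots.toFinset.filter (fun x => 0 < x)).card ≤
      m * 2 ^ (C₀ * (K + Nat.log 2 m ^ 2)) := by
  induction m with
  | zero => simp [Matrix.det_isEmpty]
  | succ n ih =>
    obtain ⟨w, hw, hle⟩ := hinc (n + 1) K d S hS hdet (Nat.succ_pos n)
    have hw0 : w ≠ 0 := by
      rintro rfl
      apply hw
      have h0 : (fun i => C ((0 : Fin (n + 1) → ℝ) i)) = 0 := by
        funext i
        simp
      rw [h0, zero_dotProduct]
    obtain ⟨c, S', hc, hS', hcomp⟩ := compDet_eq_C_mul_det_pencil d S hS w hw0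
    rw [hcomp] at hw hle
    have hdet' : (∑ l, (X : ℝ[X]) ^ d l • (S' l).map C).det ≠ 0 := by
      intro h
      apply hw
      rw [h, mul_zero]
    rw [Polynomial.roots_C_mul _ hc] at hle
    have ih' := ih S' hS' hdet'
    have hmono : 2 ^ (C₀ * (K + Nat.log 2 n ^ 2)) ≤ 2 ^ (C₀ * (K + Nat.log 2 (n + 1) ^ 2)) :=
      Nat.pow_le_pow_right Nat.two_pos (Nat.mul_le_mul_left _ (Nat.add_le_add_left
        (Nat.pow_le_pow_left (Nat.log_mono_right (Nat.le_succ n)) 2) K))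
    calc ((∑ l, (X : ℝ[X]) ^ d l • (S l).map C).det.roots.toFinset.filter (fun x => 0 < x)).card
        ≤ ((∑ l, (X : ℝ[X]) ^ d l • (S' l).map C).det.roots.toFinset.filter
            (fun x => 0 < x)).card + 2 ^ (C₀ * (K + Nat.log 2 (n + 1) ^ 2)) := hle
      _ ≤ n * 2 ^ (C₀ * (K + Nat.log 2 n ^ 2)) + 2 ^ (C₀ * (K + Nat.log 2 (n + 1) ^ 2)) :=
          Nat.add_le_add_right ih' _
      _ ≤ n * 2 ^ (C₀ * (K + Nat.log 2 (n + 1) ^ 2)) + 2 ^ (C₀ * (K + Nat.log 2 (n + 1) ^ 2)) :=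
          Nat.add_le_add_right (Nat.mul_le_mul_left n hmono) _
      _ = (n + 1) * 2 ^ (C₀ * (K + Nat.log 2 (n + 1) ^ 2)) := by ring

/-- Arithmetic of the telescope: for `K ≥ 1`, `2 m A + 1 ≤ 2^{(C₀+4)(K + log₂² m)}` where
`A = 2^{C₀ (K + log₂² m)}` (`m < 2^{log₂ m + 1}`, `log₂ m ≤ log₂² m`). [folklore] -/
theorem telescope_arith (C₀ m K : ℕ) (hK : 1 ≤ K) :
    m * 2 ^ (C₀ * (K + Nat.log 2 m ^ 2)) + m * 2 ^ (C₀ * (K + Nat.log 2 m ^ 2)) + 1 ≤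
      2 ^ ((C₀ + 4) * (K + Nat.log 2 m ^ 2)) := by
  have hm : m < 2 ^ (Nat.log 2 m + 1) := Nat.lt_pow_succ_log_self Nat.one_lt_two m
  set L := Nat.log 2 m with hL
  set A := 2 ^ (C₀ * (K + L ^ 2)) with hA
  have hA1 : 1 ≤ A := Nat.one_le_two_pow
  have hLQ : L ≤ L ^ 2 := Nat.le_self_pow two_ne_zero L
  have h1 : m * A + m * A + 1 ≤ (2 * m + 1) * A := by nlinarith
  have h2 : 2 * m + 1 ≤ 2 ^ (L + 2) := by
    have h : 2 ^ (L + 2) = 2 * 2 ^ (L + 1) := by ring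
    omega
  have h3 : (2 * m + 1) * A ≤ 2 ^ (L + 2) * A := Nat.mul_le_mul_right _ h2
  have h4 : 2 ^ (L + 2) * A = 2 ^ (L + 2 + C₀ * (K + L ^ 2)) := by
    rw [hA, ← pow_add]
  have h5 : L + 2 + C₀ * (K + L ^ 2) ≤ (C₀ + 4) * (K + L ^ 2) := by nlinarith
  have h6 : 2 ^ (L + 2 + C₀ * (K + L ^ 2)) ≤ 2 ^ ((C₀ + 4) * (K + L ^ 2)) :=
    Nat.pow_le_pow_right Nat.two_pos h5
  omega

/-- **The telescope** — the line's stub `stub_telescope : IncrementTelescope`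
(`Cruxes/MatrixDescartes/Lines/rolle_schur_residual.lean`), i.e. `IncrementLaw → KPlusLogSqLaw`,
with the line's vocabulary (`pencil`, `adjVec`, `compDet`, `posRoots`, `IncrementLaw`) UNFOLDED so
that the line closes the stub by `exact incrementTelescope`.  Proof: positive roots of `det F` and
of the reflected pencil `det F(−X)` (letters `(−1)^{dₗ} Sₗ`) by `posRoots_le_mul_of_increment`, all
real roots by the tree's `stub_negRoots` (`≤ Z₊(F) + Z₊(F(−X)) + 1`), and `telescope_arith`
(`C = C₀ + 4`); degenerate cases `det F = 0` (no roots counted), `m = 0` (`det = 1`) and `K = 0`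
(zero pencil) separately. [folklore] -/
theorem incrementTelescope :
    (∃ C₀ : ℕ, ∀ (m K : ℕ) (d : Fin K → ℕ) (S : Fin K → Matrix (Fin m) (Fin m) ℝ),
      (∀ l, (S l).IsSymm) → (∑ l, (X : ℝ[X]) ^ d l • (S l).map C).det ≠ 0 → 0 < m →
        ∃ w : Fin m → ℝ,
          (fun i => C (w i)) ⬝ᵥ ((∑ l, (X : ℝ[X]) ^ d l • (S l).map C).adjugate *ᵥ
              fun i => C (w i)) ≠ 0 ∧
            ((∑ l, (X : ℝ[X]) ^ d l • (S l).map C).det.roots.toFinset.filter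
                (fun x => 0 < x)).card ≤
              (((fun i => C (w i)) ⬝ᵥ ((∑ l, (X : ℝ[X]) ^ d l • (S l).map C).adjugate *ᵥ
                  fun i => C (w i))).roots.toFinset.filter (fun x => 0 < x)).card +
                2 ^ (C₀ * (K + Nat.log 2 m ^ 2))) →
      KPlusLogSqLaw := by
  rintro ⟨C₀, hinc⟩
  refine ⟨C₀ + 4, fun m K d S hS => ?_⟩
  -- degenerate case: the determinant vanishes identically
  by_cases hdet : (∑ l, (X : ℝ[X]) ^ d l • (S l).map C).det = 0
  · rw [hdet]
    simp
  -- degenerate case `m = 0`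
  rcases Nat.eq_zero_or_pos m with rfl | hm
  · simp [Matrix.det_isEmpty]
  -- `K = 0` is impossible when `det F ≠ 0` and `0 < m`
  rcases Nat.eq_zero_or_pos K with rfl | hK
  · exfalso
    apply hdet
    haveI : Nonempty (Fin m) := ⟨⟨0, hm⟩⟩
    simp
  -- positive roots of `F` and of `F(-X)`, all real roots, arithmetic
  have hpos := posRoots_le_mul_of_increment C₀ hinc m K d S hS hdet
  have hneg := posRoots_le_mul_of_increment C₀ hinc m K d (fun l => ((-1 : ℝ) ^ d l) • S l)
    (fun l => (hS l).smul _) (NegRoots.det_pencil_reflect_ne_zero S d hdet)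
  have htot := stub_negRoots K m d S
  have harith := telescope_arith C₀ m K hK
  omega

end RolleSchur

end Summit.ValiantsHypothesis.ValiantsHypothesis.Theorems.LacunarySymmetroidMatrixDescartes
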